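import Literature.Analysis.FluidPDE.PineauVicolEnstrophy
import Literature.Analysis.FluidPDE.PineauVicolEnstrophyTime
import Literature.Analysis.FluidPDE.PineauVicolLerayBounds
import Literature.Analysis.FluidPDE.PineauVicolRSSAlphaZero
import Literature.Analysis.FluidPDE.CurlFreeLiouville
import Summits.NavierStokesRegularity.NavierStokesRegularity.Theorems.HubbleDynamoNoSelfExcitedDynamoStubEnstrophyBalance
import HarnessLib

/-!
# The local-enstrophy floor — crux stmt-NavierStokesRegularity-1404
  (`QuantisedSymmetry.PolyhedralDssProfileExists`), line polyhedral_cell, stub `stub_enstrophyFloor` (N13)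

Helper file (all results proved) for the registered stub `stub_enstrophyFloor`: there is an absolute
`δ₀ > 0` and, for every Type-I constant `C₀`, a radius `R = R(C₀) > 0` such that a classical
Navier–Stokes solution `(u, p)` on the open past with `HasTypeIDecay C₀ u`, exactly `c`-DSS (`c > 1`),
whose Leray orbit `V = lerayOrbit u` has local enstrophy `‖curl V(s)‖_{L²(B_R)} ≤ δ₀` on every slice of
one period `[0, 2 log c]`, vanishes identically on the past. This is the `α = 0` case of the
absorption argument of Pineau–Vicol 2026 (Proposition 3.1 / (3.4) and §7.5, (7.12)), run on the
tree's α-free machinery: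

* `V`, `lerayOrbitPressure p` solve the backward Leray system on `ℝ × ℝ³`
  (`isClassicalNSSolutionOn_Iio_iff_isBackwardLeraySolutionOn`); `V` is `2 log c`-periodic
  (`IsDiscretelySelfSimilar.periodic_lerayOrbit`); `(1+|y|)|V| ≤ C₀` (`hasTypeIDecay_iff_lerayOrbit`),
  so every slice lies in `L⁴` (`memLp_four_of_profile_bound`).
* Lemma 7.1 (7.2) in Leray variables (`PineauVicol2026.exists_forall_iteratedFDeriv_lerayOrbit_le`,
  every order `k`) puts `V` in the uniform profile class `(1+|y|)^{k+1}‖DᵏV(s)‖ ≤ K_k`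
  (`enstrophyFloor_orbit_decay`), whence — by the slice tools of the route `HubbleDynamo`
  (`enstrophy_decay`, `enstrophy_slice_integrable`, `enstrophy_pointwise`) — all slice integrability
  hypotheses of the absorption theorem, the `s`-uniform dominator `A(1+|y|)⁻⁴` of the time term
  `⟪∂ₛΩ, Ω⟫`, and (dominated convergence, `enstrophyFloor_continuous_integral`) the continuity in `s`
  of `‖Ω(s)‖₂²`, `∫|DΩ(s)|²_F`, `∫⟪Ω,(DV)Ω⟫`; with `k = 1`, `‖DV(s, y)‖ ≤ K₁/|y|² ≤ ⅛` for
  `|y| ≥ R := √(8K₁) + 1`.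
* The time term integrates to zero over the period
  (`PineauVicol2026.intervalIntegral_integral_inner_timeDeriv_vorticity_eq_zero`, `θ = 0`), so
  `PineauVicol2026.curl_eq_zero_of_small_local_enstrophy` (with `δ₀ = 1/(16(C_Ω + 1))`,
  `C_Ω δ₀ < ⅛`) gives `curl V ≡ 0` on `[0, 2 log c] × ℝ³`.
* Each such slice is `C²`, divergence free, curl free and bounded, hence constant
  (`eq_of_curl_eq_zero_of_isDivFree_of_bounded`), hence zero by the profile decay
  (`enstrophyFloor_eq_zero_of_const`); periodicity spreads `V ≡ 0` to all `s`, and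
  `u(t, x) = (−t)^{−1/2} V(−log(−t), x/√(−t)) = 0` (`eq_lerayOrbit_of_neg`).

References: B. Pineau, V. Vicol, arXiv:2607.09619 (2026), Proposition 3.1, (3.3)–(3.4), Lemma 7.1,
§7.5, (7.12); Koch–Nadirashvili–Seregin–Šverák 2009, Lemma 3.1.
-/

noncomputable section

-- the summit namespace `…NavierStokesRegularity.NavierStokesRegularity…` is the tree convention (D-0017)
set_option linter.dupNamespace false

namespace Summit.NavierStokesRegularity.NavierStokesRegularity.Theorems.PolyhedralDssProfileExists.PolyhedralCell

open MeasureTheory Set Function Filter Topology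
open Literature.Analysis Literature.Analysis.FluidPDE
open scoped InnerProductSpace RealInnerProductSpace Laplacian ContDiff
open Summit.NavierStokesRegularity.NavierStokesRegularity.Theorems.NoSelfExcitedDynamo.Registered

/-! ### Three small tools -/

/-- **Dominated continuity of slice functionals.** If `F : ℝ → ℝ³ → ℝ` is jointly continuous and
dominated uniformly in `s` by `C(1+|y|)⁻⁴` (integrable on `ℝ³`), then `s ↦ ∫ F(s, y) dy` is
continuous (Lebesgue's dominated convergence theorem). [folklore] -/
theorem enstrophyFloor_continuous_integral {F : ℝ → EuclideanSpace ℝ (Fin 3) → ℝ}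
    (hc : Continuous fun z : ℝ × EuclideanSpace ℝ (Fin 3) => F z.1 z.2) {C : ℝ}
    (hb : ∀ s y, ‖F s y‖ ≤ C * ((1 + ‖y‖) ^ 4)⁻¹) : Continuous fun s => ∫ y, F s y :=
  continuous_of_dominated
    (fun _ => (hc.comp (continuous_const.prodMk continuous_id)).aestronglyMeasurable)
    (fun s => Eventually.of_forall (hb s)) (enstrophy_integrable_weight C)
    (Eventually.of_forall fun _ => hc.comp (continuous_id.prodMk continuous_const))

/-- **A constant field in the profile class vanishes**: if `(1 + ‖y‖)‖W y‖ ≤ C₀` for all `y` and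
`W` is constant, then `W = 0` (read the bound at `y = (C₀/‖W‖) e₀`). [folklore] -/
theorem enstrophyFloor_eq_zero_of_const {C₀ : ℝ}
    {W : EuclideanSpace ℝ (Fin 3) → EuclideanSpace ℝ (Fin 3)}
    (hb : ∀ y, (1 + ‖y‖) * ‖W y‖ ≤ C₀) (hconst : ∀ x y, W x = W y) : W = 0 := by
  funext y
  by_contra hy
  have hm : 0 < ‖W y‖ := norm_pos_iff.2 hy
  set z : EuclideanSpace ℝ (Fin 3) := (C₀ / ‖W y‖) • EuclideanSpace.single 0 (1 : ℝ) with hz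
  have hzn : ‖z‖ = |C₀ / ‖W y‖| := by
    rw [hz, norm_smul, PiLp.norm_single, norm_one, mul_one, Real.norm_eq_abs]
  have key := hb z
  rw [hconst z y, hzn] at key
  have e : C₀ / ‖W y‖ * ‖W y‖ = C₀ := div_mul_cancel₀ C₀ hm.ne'
  nlinarith [mul_le_mul_of_nonneg_right (le_abs_self (C₀ / ‖W y‖)) hm.le]

/-- **The Leray orbit of a Type-I classical solution lies in the uniform profile class**
`(1+|y|)^{k+1}‖DᵏV(s, y)‖ ≤ K_k` for every `k` (Pineau–Vicol, Lemma 7.1, (7.2), in Leray variables: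
`‖DᵏV(s, y)‖ ≤ K/max{|y|,1}^{k+1}`, and `(1+|y|)/max{|y|,1} ≤ 2`). [cite: PineauVicol2026, Lemma 7.1, (7.2)] -/
theorem enstrophyFloor_orbit_decay {C₀ : ℝ}
    {u : ℝ → EuclideanSpace ℝ (Fin 3) → EuclideanSpace ℝ (Fin 3)}
    {p : ℝ → EuclideanSpace ℝ (Fin 3) → ℝ}
    (hsol : IsClassicalNSSolutionOn (Iio 0) 1 0 u p) (hI : HasTypeIDecay C₀ u) (k : ℕ) :
    ∃ K : ℝ, ∀ (s : ℝ) (y : EuclideanSpace ℝ (Fin 3)),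
      (1 + ‖y‖) ^ (k + 1) * ‖iteratedFDeriv ℝ k (lerayOrbit u s) y‖ ≤ K := by
  obtain ⟨K, hK0, hK⟩ := PineauVicol2026.exists_forall_iteratedFDeriv_lerayOrbit_le k C₀
  refine ⟨2 ^ (k + 1) * K, fun s y => ?_⟩
  have h := hK u p hsol (fun t ht x => hI t ht x) s y
  have hm : 0 < max ‖y‖ 1 := lt_max_of_lt_right one_pos
  have h2 : (1 + ‖y‖) * (max ‖y‖ 1)⁻¹ ≤ 2 := by
    rw [← div_eq_mul_inv, div_le_iff₀ hm]
    have := le_max_left ‖y‖ 1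
    have := le_max_right ‖y‖ 1
    linarith
  calc (1 + ‖y‖) ^ (k + 1) * ‖iteratedFDeriv ℝ k (lerayOrbit u s) y‖
      ≤ (1 + ‖y‖) ^ (k + 1) * (K * ((max ‖y‖ 1)⁻¹) ^ (k + 1)) :=
        mul_le_mul_of_nonneg_left h (by positivity)
    _ = ((1 + ‖y‖) * (max ‖y‖ 1)⁻¹) ^ (k + 1) * K := by rw [mul_pow]; ring
    _ ≤ 2 ^ (k + 1) * K :=
        mul_le_mul_of_nonneg_right (pow_le_pow_left₀ (by positivity) h2 _) hK0

/-! ### The registered stub -/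

/-- **REGISTERED STUB `stub_enstrophyFloor` (N13): the local-enstrophy floor (Pineau–Vicol 2026,
Prop. 3.1 / §7.5 absorption, `α = 0`, on the crux's class).** There is an absolute `δ₀ > 0` and, for
every `C₀`, a radius `R = R(C₀) > 0` such that: a classical solution `(u, p)` on the open past with
`HasTypeIDecay C₀ u`, exactly `c`-DSS (`c > 1`), whose Leray orbit has local enstrophy
`‖curl U(s)‖_{L²(B_R)} ≤ δ₀` for EVERY `s` in one period `[0, 2 log c]`, is identically zero on the
past. Constants: `δ₀ = 1/(16(C_Ω + 1))` (`C_Ω = vortexConst`), `R = √(8K₁) + 1` with `K₁ = K(1, C₀)`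
of Lemma 7.1 (7.2). Proof: the orbit solves the backward Leray system on `ℝ × ℝ³`, is
`2 log c`-periodic, bounded by `C₀`, with slices in `L⁴` and in the uniform profile class (all
slice-integrability and continuity side conditions, `‖DU‖ ≤ ⅛` off `B_R`, and the vanishing of the
time term over a period); the absorption theorem `PineauVicol2026.curl_eq_zero_of_small_local_enstrophy`
gives `curl U ≡ 0` on the period; curl- and divergence-free bounded slices are constant
(`eq_of_curl_eq_zero_of_isDivFree_of_bounded`), hence zero by the profile decay; periodicity and
`u(t, x) = (−t)^{−1/2} U(−log(−t), x/√(−t))`. [cite: PineauVicol2026, Prop. 3.1 and §7.5] -/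
theorem stub_enstrophyFloor :
    ∃ δ₀ : ℝ, 0 < δ₀ ∧ ∀ C₀ : ℝ, ∃ R : ℝ, 0 < R ∧
      ∀ (c : ℝ) (u : ℝ → EuclideanSpace ℝ (Fin 3) → EuclideanSpace ℝ (Fin 3))
        (p : ℝ → EuclideanSpace ℝ (Fin 3) → ℝ), 1 < c →
        IsClassicalNSSolutionOn (Set.Iio 0) 1 0 u p → HasTypeIDecay C₀ u → IsDiscretelySelfSimilar c u →
        (∀ s ∈ Set.Icc (0 : ℝ) (2 * Real.log c),
          Real.sqrt (∫ y in Metric.ball (0 : EuclideanSpace ℝ (Fin 3)) R, ‖curl (lerayOrbit u s) y‖ ^ 2) ≤ δ₀) →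
        ∀ t < 0, ∀ x, u t x = 0 := by
  have hCΩ : 0 ≤ PineauVicol2026.vortexConst := PineauVicol2026.vortexConst_nonneg
  refine ⟨1 / (16 * (PineauVicol2026.vortexConst + 1)), by positivity, fun C₀ => ?_⟩
  have hδC : PineauVicol2026.vortexConst * (1 / (16 * (PineauVicol2026.vortexConst + 1))) < 1 / 8 := by
    rw [mul_one_div, div_lt_div_iff₀ (by positivity) (by norm_num)]
    nlinarith
  -- the radius from the first-derivative bound of Lemma 7.1 (7.2)
  obtain ⟨K₁, hK₁0, hK₁⟩ := PineauVicol2026.exists_forall_iteratedFDeriv_lerayOrbit_le 1 C₀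
  refine ⟨Real.sqrt (8 * K₁) + 1, by positivity, fun c u p hc hsol hI hdss hδ t ht x => ?_⟩
  set V : ℝ → EuclideanSpace ℝ (Fin 3) → EuclideanSpace ℝ (Fin 3) := lerayOrbit u with hV
  set S : ℝ := 2 * Real.log c with hS
  have hc0 : 0 < c := one_pos.trans hc
  have hS0 : 0 < S := mul_pos two_pos (Real.log_pos hc)
  -- (1) the orbit: backward Leray system, periodicity, profile bounds
  have hL : IsBackwardLeraySolutionOn univ 1 V (lerayOrbitPressure p) :=
    isClassicalNSSolutionOn_Iio_iff_isBackwardLeraySolutionOn.1 hsol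
  have hper : Function.Periodic V S := hdss.periodic_lerayOrbit hc0
  have hsm : IsSmoothSpaceTimeOn univ V := hL.smooth_velocity
  have hV3 : ∀ s, ContDiff ℝ 3 (V s) := fun s =>
    (hsm.contDiff_slice (mem_univ s)).of_le (by norm_cast)
  have hprof : ∀ s y, (1 + ‖y‖) * ‖V s y‖ ≤ C₀ := hasTypeIDecay_iff_lerayOrbit.1 hI
  have hVb : ∀ s y, ‖V s y‖ ≤ C₀ := fun s y => hI.norm_lerayOrbit_le' s y
  have h4 : ∀ s, MemLp (V s) 4 volume := fun s =>
    memLp_four_of_profile_bound (hV3 s).continuous fun y => hI.norm_lerayOrbit_le s y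
  -- (2a) the uniform profile class and slice integrability
  obtain ⟨K, hK0, hK⟩ := enstrophy_decay hV3 (enstrophyFloor_orbit_decay hsol hI)
  have hint := fun s => enstrophy_slice_integrable (hV3 s) hK0 (hK s)
  set κ : ℝ := ‖curlCLM‖ with hκ
  -- (2b) joint continuity of `V`, `DV`, `Ω`, `DΩ`
  have hΩsm : IsSmoothSpaceTimeOn univ (vorticity V) :=
    hsm.isSmoothSpaceTimeOn_vorticity uniqueDiffOn_univ
  have cDV := PineauVicol2026.continuous_uncurry_of_isSmoothSpaceTimeOn_univ
    (hsm.fderiv_slice uniqueDiffOn_univ)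
  have cΩ := PineauVicol2026.continuous_uncurry_of_isSmoothSpaceTimeOn_univ hΩsm
  have cDΩ := PineauVicol2026.continuous_uncurry_of_isSmoothSpaceTimeOn_univ
    (hΩsm.fderiv_slice uniqueDiffOn_univ)
  simp only [vorticity_apply] at cΩ cDΩ
  -- (2c) continuity in `s` of the three slice functionals
  have ha : Continuous fun s => ∫ y, ‖curl (V s) y‖ ^ 2 := by
    refine enstrophyFloor_continuous_integral (cΩ.norm.pow 2) (C := (κ * K) ^ 2) fun s y => ?_
    rw [Real.norm_of_nonneg (sq_nonneg _)]
    exact (hint s).2.2.2.2.2.2.2 y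
  have hb : Continuous fun s => ∫ y, frobeniusNormSq (fderiv ℝ (curl (V s)) y) := by
    refine enstrophyFloor_continuous_integral (continuous_frobeniusNormSq_clm.comp cDΩ)
      (C := 3 * K ^ 2) fun s y => ?_
    rw [Real.norm_of_nonneg (frobeniusNormSq_nonneg _)]
    have h1 : (1 : ℝ) ≤ 1 + ‖y‖ := by linarith [norm_nonneg y]
    have hD : (1 + ‖y‖) ^ 3 * ‖fderiv ℝ (curl (V s)) y‖ ≤ K := (hK s y).2.2.1
    refine (hubbleDilution_frobeniusNormSq_le _).trans ?_
    rw [← div_eq_mul_inv, le_div_iff₀ (by positivity)]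
    calc 3 * ‖fderiv ℝ (curl (V s)) y‖ ^ 2 * (1 + ‖y‖) ^ 4
        ≤ 3 * ‖fderiv ℝ (curl (V s)) y‖ ^ 2 * (1 + ‖y‖) ^ 6 :=
          mul_le_mul_of_nonneg_left (pow_le_pow_right₀ h1 (by norm_num)) (by positivity)
      _ = 3 * ((1 + ‖y‖) ^ 3 * ‖fderiv ℝ (curl (V s)) y‖) ^ 2 := by ring
      _ ≤ 3 * K ^ 2 := by gcongr
  have hst : Continuous fun s => ∫ y, ⟪curl (V s) y, fderiv ℝ (V s) y (curl (V s) y)⟫ := by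
    refine enstrophyFloor_continuous_integral (cΩ.inner (cDV.clm_apply cΩ)) (C := K * (κ * K) ^ 2)
      fun s y => ?_
    have h1 : (1 : ℝ) ≤ 1 + ‖y‖ := by linarith [norm_nonneg y]
    have hDV : ‖fderiv ℝ (V s) y‖ ≤ K :=
      (le_mul_of_one_le_left (norm_nonneg _) (one_le_pow₀ h1)).trans (hK s y).2.1
    have hΩ2 := (hint s).2.2.2.2.2.2.2 y
    rw [Real.norm_eq_abs]
    calc |⟪curl (V s) y, fderiv ℝ (V s) y (curl (V s) y)⟫|
        ≤ ‖curl (V s) y‖ * ‖fderiv ℝ (V s) y (curl (V s) y)‖ := abs_real_inner_le_norm _ _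
      _ ≤ ‖curl (V s) y‖ * (‖fderiv ℝ (V s) y‖ * ‖curl (V s) y‖) :=
          mul_le_mul_of_nonneg_left ((fderiv ℝ (V s) y).le_opNorm _) (norm_nonneg _)
      _ = ‖fderiv ℝ (V s) y‖ * ‖curl (V s) y‖ ^ 2 := by ring
      _ ≤ K * ((κ * K) ^ 2 * ((1 + ‖y‖) ^ 4)⁻¹) :=
          mul_le_mul hDV hΩ2 (sq_nonneg _) hK0
      _ = K * (κ * K) ^ 2 * ((1 + ‖y‖) ^ 4)⁻¹ := by ring
  -- (2d) `‖DV‖ ≤ ⅛` off the ball of radius `√(8K₁) + 1`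
  have hsmall : ∀ s ∈ Icc 0 S, ∀ y, Real.sqrt (8 * K₁) + 1 ≤ ‖y‖ → ‖fderiv ℝ (V s) y‖ ≤ 1 / 8 := by
    intro s _ y hy
    have hs8 : 0 ≤ Real.sqrt (8 * K₁) := Real.sqrt_nonneg _
    have hy1 : 1 ≤ ‖y‖ := by linarith
    have hy0 : 0 < ‖y‖ := by linarith
    have hmax : max ‖y‖ 1 = ‖y‖ := max_eq_left hy1
    have h := hK₁ u p hsol (fun t ht x => hI t ht x) s y
    rw [norm_iteratedFDeriv_one, hmax] at h
    have hsq : 8 * K₁ ≤ ‖y‖ ^ 2 := by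
      have e : Real.sqrt (8 * K₁) ^ 2 = 8 * K₁ := Real.sq_sqrt (by positivity)
      nlinarith
    calc ‖fderiv ℝ (V s) y‖ ≤ K₁ * (‖y‖⁻¹) ^ (1 + 1) := h
      _ = K₁ / ‖y‖ ^ 2 := by rw [inv_pow, div_eq_mul_inv]
      _ ≤ 1 / 8 := by
          rw [div_le_div_iff₀ (by positivity) (by norm_num)]
          linarith
  -- (2e) the time term over the period: dominator from the vorticity equation, then `θ = 0`
  set A : ℝ := (K * (κ * K) + K + κ * K + K / 2 + K * K) * (κ * K) with hA
  have hdom : ∀ s ∈ Icc 0 S, ∀ y,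
      |⟪timeDerivWithin univ (vorticity V) s y, curl (V s) y⟫| ≤ A * ((1 + ‖y‖) ^ 4)⁻¹ := by
    intro s _ y
    have eq := hL.vorticity_eq uniqueDiffOn_univ (by simp) (mem_univ s) y
    simp only [vorticity_apply, convect_apply, one_smul] at eq
    have e' : timeDerivWithin univ (vorticity V) s y =
        fderiv ℝ (V s) y (curl (V s) y) + (Δ (curl (V s))) y - curl (V s) y
          - (1 / 2 : ℝ) • fderiv ℝ (curl (V s)) y y - fderiv ℝ (curl (V s)) y (V s y) := by
      rw [← eq]; abel
    rw [e', ← div_eq_mul_inv, le_div_iff₀' (by positivity)]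
    exact (mul_le_mul_of_nonneg_left (abs_real_inner_le_norm _ _) (by positivity)).trans
      (enstrophy_pointwise hK0 (hK s) y).2
  have hperS : ∀ y, V S y = rotZ 0 (V 0 (rotZ (-0) y)) := fun y => by
    rw [neg_zero, rotZ_zero, rotZ_zero, ← hper 0, zero_add]
  have htime := PineauVicol2026.intervalIntegral_integral_inner_timeDeriv_vorticity_eq_zero hL hS0.le
    hperS (hint 0).1 (hint S).1 (enstrophy_integrable_weight A) hdom
  -- (3) absorption: the vorticity vanishes on the period
  have hcurl := PineauVicol2026.curl_eq_zero_of_small_local_enstrophy hL hS0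
    (fun s _ y => hVb s y) (fun s _ => h4 s) (fun s _ => (hint s).1) (fun s _ => (hint s).2.2.2.1)
    (fun s _ => (hint s).2.2.2.2.1) (fun s _ => (hint s).2.2.2.2.2.1) hsmall hδ hδC htime
    ha.continuousOn (hb.intervalIntegrable 0 S) (hst.intervalIntegrable 0 S)
  -- (4) irrotational, incompressible, bounded slices are constant, hence zero; periodicity
  have hzero : ∀ s ∈ Icc 0 S, V s = 0 := fun s hs =>
    enstrophyFloor_eq_zero_of_const (hprof s)
      (eq_of_curl_eq_zero_of_isDivFree_of_bounded ((hsm.contDiff_slice (mem_univ s)).of_le (by norm_cast))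
        (hcurl s hs) (hL.divFree s (mem_univ s)) (hVb s))
  have hall : ∀ s, V s = 0 := fun s => by
    obtain ⟨s₀, hs₀, e⟩ := hper.exists_mem_Ico₀ hS0 s
    rw [e]
    exact hzero s₀ (Ico_subset_Icc_self hs₀)
  -- (5) back to physical variables
  rw [eq_lerayOrbit_of_neg u ht x]
  change (Real.sqrt (-t))⁻¹ • V (-Real.log (-t)) ((Real.sqrt (-t))⁻¹ • x) = 0
  rw [hall]
  simp

end Summit.NavierStokesRegularity.NavierStokesRegularity.Theorems.PolyhedralDssProfileExists.PolyhedralCell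

end
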